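import Summits.Ventures.LatticeQCDFlow.Exactness.IMHSmithTierneyRecursion
import Summits.Ventures.LatticeQCDFlow.Exactness.FlowSamplerLogConvex
import HarnessLib

/-!
# The Smith–Tierney theorem for the exact flow sampler: `(Kⁿ⁺¹ g)(x) = ∫ T_{n+1}(b(x) ∨ b(z)) g(z) w(z) dμ + λ(b(x))^{n+1} g(x)`

HONEST FRAMING: exact (Metropolis-corrected) sampling algorithms for lattice gauge theory;
figures of merit are autocorrelation/cost numbers at stated couplings and volumes; no
continuum-physics claim.  (SCALAR calibration rung S0-A: not a gauge result.)

Venture `LatticeQCDFlow` (cell pub-lqcd), topic `Exactness`; FANOUT row 2 (`s0-phi4`, FLOW arm: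
real-NVP proposals + independence-Metropolis accept/reject).  NEW WORK of the cell — the fourth leg:
the exact `n`-step transition law of the independence sampler on a GENERAL state space, by
induction with the recursion identities (I1) (`IMHSmithTierneyRecursion`) and (I2)
(`IMHSmithTierneyKernel`).  Printed counterpart, NAMED ONLY (this is the cell's own proof over
Mathlib, not a citation): R. L. Smith and L. Tierney, *Exact transition probabilities for the
independence Metropolis sampler* (preprint, 1996), Theorem 1; restated as Theorem 5 of G. Wang,
*Exact convergence rate analysis of the independent Metropolis–Hastings algorithms*,
arXiv:2008.02455 [corpus: paper:arxiv-2008.02455 p.13]; Liu 1996 (finite state space) computed the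
same structure as an eigen-decomposition.

## What is proved (`w, q > 0` measurable integrable, `∫ q dμ = 1`, `b = w/q`, `K = imhOp μ w q`,
`λ = rejCurve`, `T_{n+1} = stKernel n`)

* **`stKernel_key`** — for all `a, c > 0`:
  `∫ w T_{n+1}(b ∨ c)/(a ∨ b) dμ + λ(c)^{n+1}/(a ∨ c) + λ(a) T_{n+1}(a ∨ c) = T_{n+2}(a ∨ c)`
  (case `a ≤ c` is (I1) at `c`; case `c < a` is (I1) at `a` after (I2));
* `imhOp_eq_weightForm` — `(K h)(x) = ∫ w/max(b(x), b) · h dμ + λ(b(x)) h(x)`;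
* **`imhOp_iterate_succ_eq`** — for every bounded measurable `g`, every `n`, every `x`:
  `(Kⁿ⁺¹ g)(x) = ∫ T_{n+1}(b(x) ∨ b(z)) g(z) w(z) dμ(z) + λ(b(x))^{n+1} g(x)`.

Reading: after `n+1` steps from `x` the chain sits at `x` with probability `λ(b(x))^{n+1}` (all
proposals rejected) and is otherwise spread with density `T_{n+1}(b(x) ∨ b(·))` against the target
`w dμ` — a function of the LARGER of the two importance weights only.  Consequences (the kernel
`T_{n+1}(b ∨ b')` is positive semidefinite ⇒ the all-lag sticking floor `C(n+1) ≥ ∫ g² r^{n+1} w`)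
are in `Exactness/IMHStickingFloorAllLags.lean`.  NOT CLAIMED: anything for HMC / local Metropolis;
unbounded observables; any number for a trained network.
-/

namespace Summit.Ventures.LatticeQCDFlow.Exactness

open Real MeasureTheory Filter Set Topology

variable {X : Type*} [MeasurableSpace X] {μ : Measure X} {w q : X → ℝ}

variable [SFinite μ]

/-- **THE KEY IDENTITY** of the induction: for all `a, c > 0`,
`∫ w T(b ∨ c)/(a ∨ b) dμ + λ(c)^{n+1}/(a ∨ c) + λ(a) T(a ∨ c) = T_{n+2}(a ∨ c)` (`T = T_{n+1}`). -/
theorem stKernel_key (hw0 : ∀ t, 0 < w t) (hwm : Measurable w) (hwi : Integrable w μ)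
    (hq0 : ∀ t, 0 < q t) (hqm : Measurable q) (hqi : Integrable q μ) (hq1 : ∫ z, q z ∂μ = 1)
    (n : ℕ) {a c : ℝ} (ha : 0 < a) (hc : 0 < c) :
    (∫ z, w z * stKernel μ w q n (max (w z / q z) c) / max a (w z / q z) ∂μ)
      + rejCurve μ w q c ^ (n + 1) / max a c + rejCurve μ w q a * stKernel μ w q n (max a c)
      = stKernel μ w q (n + 1) (max a c) := by
  have hSm : Measurable (stKernel μ w q n) := measurable_stKernel hwm hqm n
  have hbm : Measurable fun z => w z / q z := hwm.div hqm
  have hb0 : ∀ z, 0 < w z / q z := fun z => div_pos (hw0 z) (hq0 z)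
  have hSb : ∀ v, 0 < v → 0 ≤ stKernel μ w q n v ∧ stKernel μ w q n v ≤ ((n : ℝ) + 1) / v :=
    fun v hv => stKernel_bounds hw0 hwm hq0 hqm hqi hq1 n hv
  -- the `E_q` term `∫ 1[v < b] T(b) q` is integrable for every `v > 0`
  have hEint : ∀ v, 0 < v →
      Integrable (fun z => (if v < w z / q z then stKernel μ w q n (w z / q z) * q z else 0 : ℝ)) μ := by
    intro v hv
    refine Integrable.mono' (hqi.const_mul (((n : ℝ) + 1) / v))
      ((Measurable.ite (measurableSet_lt measurable_const hbm) ((hSm.comp hbm).mul hqm)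
        measurable_const).aestronglyMeasurable) (Eventually.of_forall fun z => ?_)
    rw [Real.norm_eq_abs]
    split_ifs with h
    · obtain ⟨h0, h1⟩ := hSb _ (hb0 z)
      rw [abs_of_nonneg (mul_nonneg h0 (hq0 z).le)]
      refine mul_le_mul_of_nonneg_right (h1.trans ?_) (hq0 z).le
      exact div_le_div_of_nonneg_left (by positivity) hv h.le
    · rw [abs_zero]
      exact mul_nonneg (div_nonneg (by positivity) hv.le) (hq0 z).le
  rcases le_or_gt a c with hac | hca
  · -- Case `a ≤ c`: `max a c = c`
    rw [max_eq_right hac]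
    have hpt : ∀ z, w z * stKernel μ w q n (max (w z / q z) c) / max a (w z / q z)
        = stKernel μ w q n c * (if w z / q z ≤ c then w z / max a (w z / q z) else 0)
          + (if c < w z / q z then stKernel μ w q n (w z / q z) * q z else 0) := by
      intro z
      by_cases h : w z / q z ≤ c
      · rw [max_eq_right h, if_pos h, if_neg (not_lt.2 h)]
        ring
      · have h' : c < w z / q z := not_le.1 h
        have hab : a ≤ w z / q z := hac.trans h'.le
        rw [max_eq_left h'.le, if_neg h, if_pos h', max_eq_right hab]
        have hqz := (hq0 z).ne'
        have hwz := (hw0 z).ne'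
        field_simp
        ring
    simp_rw [hpt]
    have hI1 : Integrable (fun z => (if w z / q z ≤ c then w z / max a (w z / q z) else 0 : ℝ)) μ := by
      refine Integrable.mono' (hwi.div_const a)
        ((Measurable.ite (measurableSet_le hbm measurable_const)
          (hwm.div (measurable_const.max hbm)) measurable_const).aestronglyMeasurable)
        (Eventually.of_forall fun z => ?_)
      rw [Real.norm_eq_abs]
      split_ifs
      · rw [abs_of_nonneg (div_nonneg (hw0 z).le (le_max_of_le_left ha.le))]
        exact div_le_div_of_nonneg_left (hw0 z).le ha (le_max_left _ _)
      · rw [abs_zero]; exact div_nonneg (hw0 z).le ha.le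
    rw [integral_add (hI1.const_mul _) (hEint c hc), integral_const_mul]
    -- `∫ 1[b ≤ c] w/max(a,b) = P̃(c) − λ(a)`
    have hJ : ∫ z, (if w z / q z ≤ c then w z / max a (w z / q z) else 0 : ℝ) ∂μ
        = qMassLe μ w q c - rejCurve μ w q a := by
      obtain ⟨hiq, -, -⟩ := integrable_qMassLe_integrand hwm hq0 hqm hqi c
      unfold qMassLe rejCurve
      rw [← integral_sub hiq (integrable_rejCurve_integrand hw0 hwm hq0 hqm hqi ha)]
      exact integral_congr_ae (Eventually.of_forall fun z => key_pointwise_le hw0 hq0 ha hac z)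
    rw [hJ, stKernel_I1 hw0 hwm hwi hq0 hqm hqi hq1 n hc]
    ring
  · -- Case `c < a`: `max a c = a`
    rw [max_eq_left hca.le]
    have hpt : ∀ z, w z * stKernel μ w q n (max (w z / q z) c) / max a (w z / q z)
        = a⁻¹ * (if w z / q z ≤ a then
            (stKernel μ w q n (max (w z / q z) c) - stKernel μ w q n a) * w z else 0)
          + a⁻¹ * stKernel μ w q n a * (if w z / q z ≤ a then w z else 0)
          + (if a < w z / q z then stKernel μ w q n (w z / q z) * q z else 0) := by
      intro z
      by_cases h : w z / q z ≤ a
      · rw [max_eq_left h, if_pos h, if_pos h, if_neg (not_lt.2 h)]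
        field_simp
        ring
      · have h' : a < w z / q z := not_le.1 h
        rw [max_eq_right h'.le, if_neg h, if_neg h, if_pos h', max_eq_left (hca.trans h').le]
        have hqz := (hq0 z).ne'
        have hwz := (hw0 z).ne'
        field_simp
        ring
    simp_rw [hpt]
    -- integrability of the three pieces
    have hI2int : Integrable (fun z => (if w z / q z ≤ a then
        (stKernel μ w q n (max (w z / q z) c) - stKernel μ w q n a) * w z else 0 : ℝ)) μ := by
      refine Integrable.mono' (hwi.const_mul (((n : ℝ) + 1) / c + ((n : ℝ) + 1) / a))
        ((Measurable.ite (measurableSet_le hbm measurable_const)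
          (((hSm.comp (hbm.max measurable_const)).sub measurable_const).mul hwm)
          measurable_const).aestronglyMeasurable) (Eventually.of_forall fun z => ?_)
      rw [Real.norm_eq_abs]
      split_ifs
      · have hm0 : 0 < max (w z / q z) c := lt_max_of_lt_right hc
        obtain ⟨h0, h1⟩ := hSb _ hm0
        obtain ⟨h0', h1'⟩ := hSb a ha
        have t1 : |stKernel μ w q n (max (w z / q z) c)| ≤ ((n : ℝ) + 1) / c := by
          rw [abs_of_nonneg h0]
          exact h1.trans (div_le_div_of_nonneg_left (by positivity) hc (le_max_right _ _))
        have t2 : |stKernel μ w q n a| ≤ ((n : ℝ) + 1) / a := by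
          rw [abs_of_nonneg h0']
          exact h1'
        rw [abs_mul, abs_of_pos (hw0 z)]
        exact mul_le_mul_of_nonneg_right ((abs_sub _ _).trans (add_le_add t1 t2)) (hw0 z).le
      · rw [abs_zero]; exact mul_nonneg (by positivity) (hw0 z).le
    obtain ⟨-, hLint⟩ := integrable_mass_integrands hw0 hwm hwi hqm a (q := q)
    have i1 : Integrable (fun z => a⁻¹ * (if w z / q z ≤ a then
        (stKernel μ w q n (max (w z / q z) c) - stKernel μ w q n a) * w z else 0 : ℝ)) μ :=
      hI2int.const_mul _
    have i2 : Integrable (fun z => a⁻¹ * stKernel μ w q n a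
        * (if w z / q z ≤ a then w z else 0 : ℝ)) μ := hLint.const_mul _
    have i12 : Integrable (fun z => a⁻¹ * (if w z / q z ≤ a then
        (stKernel μ w q n (max (w z / q z) c) - stKernel μ w q n a) * w z else 0 : ℝ)
        + a⁻¹ * stKernel μ w q n a * (if w z / q z ≤ a then w z else 0 : ℝ)) μ := i1.add i2
    rw [integral_add i12 (hEint a ha), integral_add i1 i2, MeasureTheory.integral_const_mul,
      MeasureTheory.integral_const_mul, stKernel_I2 hw0 hwm hwi hq0 hqm hqi hq1 n hc hca.le,
      stKernel_I1 hw0 hwm hwi hq0 hqm hqi hq1 n ha]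
    have hM : (∫ z, (if w z / q z ≤ a then w z else 0 : ℝ) ∂μ)
        = a * (qMassLe μ w q a - rejCurve μ w q a) := by
      rw [show (∫ z, (if w z / q z ≤ a then w z else 0 : ℝ) ∂μ) = massLe μ w q a from rfl,
        rejCurve_eq_qMassLe_sub hw0 hwm hwi hq0 hqm hqi ha]
      field_simp
      ring
    rw [hM]
    have hane := ha.ne'
    field_simp
    ring

/-! ## The theorem -/

omit [SFinite μ] in
/-- **One step of the sampler in weight form**: for bounded measurable `h`,
`(K h)(x) = ∫ w(z)/max(b(x), b(z)) · h(z) dμ + λ(b(x)) h(x)`. -/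
theorem imhOp_eq_weightForm (hw0 : ∀ t, 0 < w t) (hwm : Measurable w) (hq0 : ∀ t, 0 < q t)
    (hqm : Measurable q) (hqi : Integrable q μ) {h : X → ℝ} (hhm : Measurable h) {B : ℝ}
    (hhb : ∀ t, |h t| ≤ B) (x : X) :
    imhOp μ w q h x = (∫ z, w z / max (w x / q x) (w z / q z) * h z ∂μ)
      + rejCurve μ w q (w x / q x) * h x := by
  unfold imhOp
  have ham : Measurable fun z => imhAcceptQ w q x z :=
    (measurable_imhAcceptQ hwm hqm).comp (measurable_const.prodMk measurable_id)
  have ha01 : ∀ z, 0 ≤ imhAcceptQ w q x z ∧ imhAcceptQ w q x z ≤ 1 :=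
    fun z => ⟨imhAcceptQ_nonneg hw0 hq0 x z, imhAcceptQ_le_one w q x z⟩
  have hI1 : Integrable (fun z => imhAcceptQ w q x z * q z * h z) μ := by
    refine Integrable.mono' (hqi.const_mul B) ((ham.mul hqm).mul hhm).aestronglyMeasurable
      (Eventually.of_forall fun z => ?_)
    obtain ⟨h0, h1⟩ := ha01 z
    rw [Real.norm_eq_abs, abs_mul, abs_mul, abs_of_nonneg h0, abs_of_pos (hq0 z)]
    calc imhAcceptQ w q x z * q z * |h z| ≤ 1 * q z * B :=
          mul_le_mul (mul_le_mul_of_nonneg_right h1 (hq0 z).le) (hhb z) (abs_nonneg _)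
            (by rw [one_mul]; exact (hq0 z).le)
      _ = B * q z := by ring
  have hI2 : Integrable (fun z => (1 - imhAcceptQ w q x z) * q z * h x) μ := by
    refine Integrable.mono' (hqi.const_mul B) (((measurable_const.sub ham).mul hqm).mul
      measurable_const).aestronglyMeasurable (Eventually.of_forall fun z => ?_)
    obtain ⟨h0, h1⟩ := ha01 z
    rw [Real.norm_eq_abs, abs_mul, abs_mul, abs_of_nonneg (sub_nonneg.2 h1), abs_of_pos (hq0 z)]
    calc (1 - imhAcceptQ w q x z) * q z * |h x| ≤ 1 * q z * B :=
          mul_le_mul (mul_le_mul_of_nonneg_right (by linarith) (hq0 z).le) (hhb x) (abs_nonneg _)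
            (by rw [one_mul]; exact (hq0 z).le)
      _ = B * q z := by ring
  have e : ∀ z, (imhAcceptQ w q x z * h z + (1 - imhAcceptQ w q x z) * h x) * q z
      = imhAcceptQ w q x z * q z * h z + (1 - imhAcceptQ w q x z) * q z * h x := fun z => by ring
  simp_rw [e]
  rw [integral_add hI1 hI2, MeasureTheory.integral_mul_const, rejection_eq_rejCurve hw0 hq0]
  congr 1
  refine integral_congr_ae (Eventually.of_forall fun z => ?_)
  show imhAcceptQ w q x z * q z * h z = w z / max (w x / q x) (w z / q z) * h z
  rw [imhAcceptQ_mul_q hw0 hq0]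

/-- **THE SMITH–TIERNEY THEOREM FOR THE EXACT FLOW SAMPLER (general state space).**
`w, q > 0` measurable integrable with `∫ q = 1`, `b = w/q`, `K = imhOp μ w q`,
`T_{n+1}(v) = ∫_{u>v} (n+1)λ(u)ⁿ/u² du`, `λ` the rejection curve.  For every bounded measurable `g`,
every `n` and every state `x`:
`(Kⁿ⁺¹ g)(x) = ∫ T_{n+1}(b(x) ∨ b(z)) g(z) w(z) dμ(z) + λ(b(x))^{n+1} g(x)`
— the `n`-step law is an absolutely continuous part with density `T_{n+1}(b(x) ∨ b(·))` against
`w dμ` plus the atom `λ(b(x))^{n+1}` (all `n+1` proposals rejected) at `x`. -/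
theorem imhOp_iterate_succ_eq (hw0 : ∀ t, 0 < w t) (hwm : Measurable w) (hwi : Integrable w μ)
    (hq0 : ∀ t, 0 < q t) (hqm : Measurable q) (hqi : Integrable q μ) (hq1 : ∫ z, q z ∂μ = 1)
    {B : ℝ} : ∀ (n : ℕ) {g : X → ℝ}, Measurable g → (∀ t, |g t| ≤ B) → ∀ x,
      ((imhOp μ w q)^[n + 1] g) x
        = (∫ z, stKernel μ w q n (max (w x / q x) (w z / q z)) * g z * w z ∂μ)
          + rejCurve μ w q (w x / q x) ^ (n + 1) * g x
  | 0, g, hgm, hgb, x => by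
    have hb0 : ∀ z, 0 < w z / q z := fun z => div_pos (hw0 z) (hq0 z)
    rw [Function.iterate_one, pow_one, imhOp_eq_weightForm hw0 hwm hq0 hqm hqi hgm hgb x]
    congr 1
    refine integral_congr_ae (Eventually.of_forall fun z => ?_)
    show w z / max (w x / q x) (w z / q z) * g z
      = stKernel μ w q 0 (max (w x / q x) (w z / q z)) * g z * w z
    rw [stKernel_zero (lt_max_of_lt_left (hb0 x))]
    ring
  | n + 1, g, hgm, hgb, x => by
    have IH := imhOp_iterate_succ_eq hw0 hwm hwi hq0 hqm hqi hq1 n hgm hgb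
    obtain ⟨hhm, hhb⟩ := imhOp_iterate_bdd (μ := μ) hw0 hwm hq0 hqm hqi hq1 (n + 1) hgm hgb
    have hb0 : ∀ z, 0 < w z / q z := fun z => div_pos (hw0 z) (hq0 z)
    have hbm : Measurable fun z => w z / q z := hwm.div hqm
    have hSm : Measurable (stKernel μ w q n) := measurable_stKernel hwm hqm n
    have hSb : ∀ v, 0 < v → 0 ≤ stKernel μ w q n v ∧ stKernel μ w q n v ≤ ((n : ℝ) + 1) / v :=
      fun v hv => stKernel_bounds hw0 hwm hq0 hqm hqi hq1 n hv
    have hlam : ∀ v, 0 < v → 0 ≤ rejCurve μ w q v ∧ rejCurve μ w q v ≤ 1 := fun v hv => by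
      obtain ⟨h0, h1⟩ := rejCurve_bounds hw0 hq0 hqi hv (μ := μ)
      rw [hq1] at h1
      exact ⟨h0, h1⟩
    have hB : 0 ≤ B := (abs_nonneg _).trans (hgb x)
    set a := w x / q x with ha_def
    have ha : 0 < a := hb0 x
    rw [Function.iterate_succ_apply', imhOp_eq_weightForm hw0 hwm hq0 hqm hqi hhm hhb x, IH x]
    -- substitute the IH inside the `z`-integral
    have hsub : ∫ z, w z / max a (w z / q z) * ((imhOp μ w q)^[n + 1] g) z ∂μ
        = ∫ z, w z / max a (w z / q z) *
            ((∫ y, stKernel μ w q n (max (w z / q z) (w y / q y)) * g y * w y ∂μ)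
              + rejCurve μ w q (w z / q z) ^ (n + 1) * g z) ∂μ :=
      integral_congr_ae (Eventually.of_forall fun z => by
        dsimp only
        rw [IH z])
    rw [hsub]
    -- the joint integrand `F(z, y)` and its integrability on `μ ⊗ μ`
    set F : X → X → ℝ := fun z y => w z / max a (w z / q z)
      * (stKernel μ w q n (max (w z / q z) (w y / q y)) * g y * w y) with hF
    have hFint : Integrable (Function.uncurry F) (μ.prod μ) := by
      have hmeas : Measurable (Function.uncurry F) :=
        ((hwm.comp measurable_fst).div (measurable_const.max (hbm.comp measurable_fst))).mul
          (((hSm.comp ((hbm.comp measurable_fst).max (hbm.comp measurable_snd))).mul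
            (hgm.comp measurable_snd)).mul (hwm.comp measurable_snd))
      have hG : Integrable (fun p : X × X => w p.1 * ((((n : ℝ) + 1) * B / a) * q p.2)) (μ.prod μ) :=
        hwi.mul_prod (hqi.const_mul _)
      refine Integrable.mono' hG hmeas.aestronglyMeasurable (Eventually.of_forall fun p => ?_)
      obtain ⟨hS0, hS1⟩ := hSb _ (lt_max_of_lt_left (hb0 p.1) : 0 < max (w p.1 / q p.1) (w p.2 / q p.2))
      rw [Real.norm_eq_abs]
      show |w p.1 / max a (w p.1 / q p.1)
          * (stKernel μ w q n (max (w p.1 / q p.1) (w p.2 / q p.2)) * g p.2 * w p.2)|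
        ≤ w p.1 * ((((n : ℝ) + 1) * B / a) * q p.2)
      rw [abs_mul, abs_mul, abs_mul, abs_of_pos (hw0 p.2), abs_of_nonneg hS0,
        abs_of_nonneg (div_nonneg (hw0 p.1).le (le_max_of_le_left ha.le))]
      have h1 : w p.1 / max a (w p.1 / q p.1) ≤ w p.1 / a :=
        div_le_div_of_nonneg_left (hw0 p.1).le ha (le_max_left _ _)
      have h2 : stKernel μ w q n (max (w p.1 / q p.1) (w p.2 / q p.2)) ≤ ((n : ℝ) + 1) / (w p.2 / q p.2) :=
        hS1.trans (div_le_div_of_nonneg_left (by positivity) (hb0 p.2) (le_max_right _ _))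
      have hq2 := (hq0 p.2).ne'
      have hw2 := hw0 p.2
      calc w p.1 / max a (w p.1 / q p.1)
            * (stKernel μ w q n (max (w p.1 / q p.1) (w p.2 / q p.2)) * |g p.2| * w p.2)
          ≤ (w p.1 / a) * (((n : ℝ) + 1) / (w p.2 / q p.2) * B * w p.2) := by
            refine mul_le_mul h1 ?_ (mul_nonneg (mul_nonneg hS0 (abs_nonneg _)) hw2.le)
              (div_nonneg (hw0 p.1).le ha.le)
            exact mul_le_mul_of_nonneg_right (mul_le_mul h2 (hgb _) (abs_nonneg _)
              (div_nonneg (by positivity) (hb0 p.2).le)) hw2.le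
        _ = w p.1 * ((((n : ℝ) + 1) * B / a) * q p.2) := by
            field_simp
    -- Fubini on the double integral, and integrability of the three `y`-pieces
    have hT2 : Integrable (fun z => w z / max a (w z / q z)
        * (rejCurve μ w q (w z / q z) ^ (n + 1) * g z)) μ := by
      refine Integrable.mono' (hwi.const_mul (B / a))
        (((hwm.div (measurable_const.max hbm)).mul
          ((((measurable_rejCurve hwm hqm).comp hbm).pow_const _).mul hgm)).aestronglyMeasurable)
        (Eventually.of_forall fun z => ?_)
      obtain ⟨hl0, hl1⟩ := hlam _ (hb0 z)
      rw [Real.norm_eq_abs, abs_mul, abs_mul,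
        abs_of_nonneg (div_nonneg (hw0 z).le (le_max_of_le_left ha.le)),
        abs_of_nonneg (pow_nonneg hl0 _)]
      have h1 : w z / max a (w z / q z) ≤ w z / a :=
        div_le_div_of_nonneg_left (hw0 z).le ha (le_max_left _ _)
      calc w z / max a (w z / q z) * (rejCurve μ w q (w z / q z) ^ (n + 1) * |g z|)
          ≤ (w z / a) * (1 * B) :=
            mul_le_mul h1 (mul_le_mul (pow_le_one₀ hl0 hl1) (hgb z) (abs_nonneg _) zero_le_one)
              (mul_nonneg (pow_nonneg hl0 _) (abs_nonneg _)) (div_nonneg (hw0 z).le ha.le)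
        _ = B / a * w z := by
            field_simp
    have hT3 : Integrable (fun y => stKernel μ w q n (max a (w y / q y)) * g y * w y) μ := by
      obtain ⟨hS0a, hS1a⟩ := hSb a ha
      refine Integrable.mono' (hwi.const_mul (((n : ℝ) + 1) / a * B))
        (((hSm.comp (measurable_const.max hbm)).mul hgm).mul hwm).aestronglyMeasurable
        (Eventually.of_forall fun y => ?_)
      obtain ⟨hS0, hS1⟩ := hSb _ (lt_max_of_lt_left ha : 0 < max a (w y / q y))
      rw [Real.norm_eq_abs, abs_mul, abs_mul, abs_of_nonneg hS0, abs_of_pos (hw0 y)]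
      refine mul_le_mul_of_nonneg_right ?_ (hw0 y).le
      exact mul_le_mul (hS1.trans (div_le_div_of_nonneg_left (by positivity) ha (le_max_left _ _)))
        (hgb y) (abs_nonneg _) (by positivity)
    have hsplit : ∫ z, w z / max a (w z / q z) *
        ((∫ y, stKernel μ w q n (max (w z / q z) (w y / q y)) * g y * w y ∂μ)
          + rejCurve μ w q (w z / q z) ^ (n + 1) * g z) ∂μ
        = (∫ y, (∫ z, F z y ∂μ) ∂μ)
          + ∫ z, w z / max a (w z / q z) * (rejCurve μ w q (w z / q z) ^ (n + 1) * g z) ∂μ := by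
      have e : ∀ z, w z / max a (w z / q z) *
          ((∫ y, stKernel μ w q n (max (w z / q z) (w y / q y)) * g y * w y ∂μ)
            + rejCurve μ w q (w z / q z) ^ (n + 1) * g z)
          = (∫ y, F z y ∂μ) + w z / max a (w z / q z) * (rejCurve μ w q (w z / q z) ^ (n + 1) * g z) := by
        intro z
        rw [mul_add, ← MeasureTheory.integral_const_mul]
      simp_rw [e]
      have hI1' : Integrable (fun z => ∫ y, F z y ∂μ) μ := hFint.integral_prod_left
      rw [integral_add hI1' hT2, integral_integral_swap hFint]
    rw [hsplit]
    -- assemble: the three `y`-integrals combine through the KEY identity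
    have hJ : ∀ y, ∫ z, F z y ∂μ = g y * w y *
        ∫ z, w z * stKernel μ w q n (max (w z / q z) (w y / q y)) / max a (w z / q z) ∂μ := by
      intro y
      rw [← MeasureTheory.integral_const_mul]
      refine integral_congr_ae (Eventually.of_forall fun z => ?_)
      simp only [hF]
      ring
    have hJint : Integrable (fun y => ∫ z, F z y ∂μ) μ := hFint.swap.integral_prod_left
    have i12 : Integrable (fun y => (∫ z, F z y ∂μ)
        + w y / max a (w y / q y) * (rejCurve μ w q (w y / q y) ^ (n + 1) * g y)) μ := hJint.add hT2
    have i3 : Integrable (fun y => rejCurve μ w q a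
        * (stKernel μ w q n (max a (w y / q y)) * g y * w y)) μ := hT3.const_mul _
    calc (∫ y, (∫ z, F z y ∂μ) ∂μ)
          + ∫ z, w z / max a (w z / q z) * (rejCurve μ w q (w z / q z) ^ (n + 1) * g z) ∂μ
          + rejCurve μ w q a * ((∫ y, stKernel μ w q n (max a (w y / q y)) * g y * w y ∂μ)
            + rejCurve μ w q a ^ (n + 1) * g x)
        = (∫ y, ((∫ z, F z y ∂μ)
            + w y / max a (w y / q y) * (rejCurve μ w q (w y / q y) ^ (n + 1) * g y)
            + rejCurve μ w q a * (stKernel μ w q n (max a (w y / q y)) * g y * w y)) ∂μ)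
          + rejCurve μ w q a ^ (n + 1 + 1) * g x := by
          rw [integral_add i12 i3, integral_add hJint hT2, MeasureTheory.integral_const_mul]
          ring
      _ = (∫ y, stKernel μ w q (n + 1) (max a (w y / q y)) * g y * w y ∂μ)
          + rejCurve μ w q a ^ (n + 1 + 1) * g x := by
          congr 1
          refine integral_congr_ae (Eventually.of_forall fun y => ?_)
          have hkey := stKernel_key hw0 hwm hwi hq0 hqm hqi hq1 n ha (hb0 y)
          dsimp only
          rw [hJ y, ← hkey]
          have hmy : 0 < max a (w y / q y) := lt_max_of_lt_left ha
          field_simp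

end Summit.Ventures.LatticeQCDFlow.Exactness
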